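import Summits.CriticalPhenomena.PercolationContinuityZ3.Theses.PercNearOneGluing
import Literature.Probability.Percolation.PercolationEvents
import Literature.Probability.Percolation.DecisionTreeWeighted
import HarnessLib.Audit

/-!
# Strategist s3 sketch — crux `NearOneGluing` (stmt-CriticalPhenomena-4574)

Typed first lemmas for the census entries and the two crux ideas of session s3
(planner-cstrat-stmt-CriticalPhenomena-4574-s3-0, 2026-08-17).  Everything is a `Prop`
(no `sorry`); the file only has to ELABORATE.  Notation: `μ = prodBernoulli w` on bond
configurations of the complete graph on `Fin n`, `P(x ↔ y) = μ.real (openConn x y)`.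

* `WeakestUniformGluing`      — the rung **W** (census §Decomposition D7 / idea `weakest-uniform-gluing`):
                                 SOME positive, `|A|`-uniform lower bound on `P(o ↔ b)`.
* `AmplificationStep`         — **Amp**: `W → NearOneGluing` (the piece that stays crux-hard).
* `secondMomentGluing_stmt`   — Paley–Zygmund gluing `t²·(E N)² ≤ P(o↔b)·E[N²]` (provable now).
* `thm12Step_stmt`            — the one-edge step behind KN Thm 12 (census T10), provable now.
* `osss_stmt`, `levelOne_stmt`— the two Boolean-analysis inputs of idea `osss-level1-revealment`,
                                 stated in the finitary decision-tree calculus of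
                                 `Literature/Probability/Percolation/DecisionTreeWeighted.lean`.
-/

namespace Summit.CriticalPhenomena.PercolationContinuityZ3.Cruxes.NearOneGluing.StrategistS3

open MeasureTheory Set Literature.Probability.LatticeModels Literature.Probability.Percolation
open scoped Classical BigOperators

/-- **W — the weakest uniform consequence of the crux.**  There are `η > 0` and `δ > 0` such that
on EVERY finite weighted graph, `P(o ↔ A) > 1 - δ` and `P(a ↔ b) > 1 - δ ∀ a ∈ A` force
`P(o ↔ b) ≥ η`.  (`NearOneGluing` is the same with `η = 1 - ε` for every `ε`; W only asks that
`o` is not essentially NEVER glued.)  By `logGluing` a W-counterexample needs `log₂|A| ≳ 1/(16δ)`. -/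
def WeakestUniformGluing : Prop :=
  ∃ η : ℝ, 0 < η ∧ ∃ δ : ℝ, 0 < δ ∧ ∀ (n : ℕ) (w : Sym2 (Fin n) → unitInterval)
    (A : Finset (Fin n)) (o b : Fin n),
    1 - δ < (prodBernoulli w).real (⋃ a ∈ A, openConn o a) →
    (∀ a ∈ A, 1 - δ < (prodBernoulli w).real (openConn a b)) →
      η ≤ (prodBernoulli w).real (openConn o b)

/-- **Amp — amplification**, the second piece of the bridge split `crux ⟺ W ∧ (W → crux)`.
No mechanism is known (census D7: parallel powers collapse, series powers and un-boosting destroy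
the hypotheses — fragile chains; the repair is a renormalisation whose contraction error is again
a gluing statement). -/
def AmplificationStep : Prop :=
  WeakestUniformGluing →
    Summit.CriticalPhenomena.PercolationContinuityZ3.Theses.PercNearOneGluing.NearOneGluing

/-- The bridge split is a tautology (recorded so nobody mistakes it for progress). -/
theorem nearOneGluing_of_W_and_amp (hW : WeakestUniformGluing) (hAmp : AmplificationStep) :
    Summit.CriticalPhenomena.PercolationContinuityZ3.Theses.PercNearOneGluing.NearOneGluing :=
  hAmp hW

/-- **Second-moment (Paley–Zygmund) gluing** (provable now, ~20 lines): with
`N = #{a ∈ A : o ↔ a}` and `Z = #{a ∈ A : o ↔ a ↔ b} ≤ N · 1{o ↔ b}`,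
`(E Z)² ≤ P(o ↔ b) · E[N²]` and `E Z ≥ t · E N` (Harris per relay), i.e.
`t² (Σ_a P(o↔a))² ≤ P(o↔b) · Σ_{a,a'} P(o↔a, o↔a')`.  It proves W exactly when the relay
count seen from `o` has bounded coefficient of variation; a W-counterexample therefore has
`E[N²] ≫ (E N)²` (all of `N`'s mass on the rare event `{o ↔ b}`). -/
def secondMomentGluing_stmt : Prop :=
  ∀ (n : ℕ) (w : Sym2 (Fin n) → unitInterval) (A : Finset (Fin n)) (o b : Fin n) (t : ℝ),
    0 ≤ t → (∀ a ∈ A, t ≤ (prodBernoulli w).real (openConn a b)) →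
      t ^ 2 * (∑ a ∈ A, (prodBernoulli w).real (openConn o a)) ^ 2 ≤
        (prodBernoulli w).real (openConn o b) *
          ∑ a ∈ A, ∑ a' ∈ A, (prodBernoulli w).real (openConn o a ∩ openConn o a')

/-- **The one-edge step behind Kozma–Nitzan Theorem 12** (arXiv:2401.12397 §5.4), in the form the
census uses (T10): for the Conjecture-1 functional `f_a(w) = P(o↔b) − P(o↔A)·P(a↔b)` with a FIXED
relay `a`, contracting one pair `e` (weight raised from `w e` to `1`) can raise `f_a` by at most
`(1 − w e) · P(e pivotal for o ↔ b)`: `f_a` is concave along the coordinate and the product term is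
non-decreasing.  Pivotality of the pair `e` for `{o ↔ b}` is written with `insert`/`erase`.
Provable now from the one-bond decomposition (`…AdditiveGluingOneBond.lean`). -/
def thm12Step_stmt : Prop :=
  ∀ (n : ℕ) (w : Sym2 (Fin n) → unitInterval) (A : Finset (Fin n)) (o b a : Fin n)
    (e : Sym2 (Fin n)),
    ((prodBernoulli (Function.update w e 1)).real (openConn o b) -
        (prodBernoulli (Function.update w e 1)).real (⋃ x ∈ A, openConn o x) *
          (prodBernoulli (Function.update w e 1)).real (openConn a b)) -
      ((prodBernoulli w).real (openConn o b) -
        (prodBernoulli w).real (⋃ x ∈ A, openConn o x) * (prodBernoulli w).real (openConn a b)) ≤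
    (1 - (w e : ℝ)) *
      (prodBernoulli w).real {ω | insert e ω ∈ openConn o b ∧ ω \ {e} ∉ openConn o b}

/-! ### The two inputs of idea `osss-level1-revealment` (finitary calculus of `DecisionTree`) -/

section Finitary

open Literature.Probability.Percolation.DecisionTree

variable {ι : Type*} [DecidableEq ι]

/-- Revealment of coordinate `i` under the tree `T`: the probability that `T` queries `i`. -/
noncomputable def revealment (D : Finset ι) (p : ι → ℝ) (T : DTree ι) (i : ι) : ℝ :=
  PrW D p {S | i ∈ revealed T S}

/-- Pivotality of coordinate `i` for the event `X`. -/
noncomputable def pivotality (D : Finset ι) (p : ι → ℝ) (X : Set (Finset ι)) (i : ι) : ℝ :=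
  PrW D p {S | (insert i S ∈ X) ≠ (S.erase i ∈ X)}

/-- **OSSS (O'Donnell–Saks–Schramm–Servedio 2005, Thm 3.1) for deterministic trees, product
weights `p_i`**: if `X` is decided by what `T` reveals (`LocalOn (revealed T) X`) then
`P(X)(1 − P(X)) ≤ Σ_i δ_i(T) · 2 p_i (1 − p_i) · P(i pivotal for X)`.
Not in the tree (`ClusterExploration.lean`: "Mathlib's decision-tree / OSSS material does not
exist"); size M–L over `DecisionTreeWeighted`. -/
def osss_stmt : Prop :=
  ∀ (ι : Type) [DecidableEq ι] (D : Finset ι) (p : ι → ℝ), (∀ i, 0 ≤ p i) → (∀ i, p i ≤ 1) →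
    ∀ (T : DTree ι) (X : Set (Finset ι)), LocalOn (revealed T) X →
      PrW D p X * (1 - PrW D p X) ≤
        ∑ i ∈ D, revealment D p T i * (2 * p i * (1 - p i)) * pivotality D p X i

/-- **Talagrand's level-1 inequality (Talagrand 1996 Thm 1.1; O'Donnell 2014 §5.4), uniform
weights `1/2`**: for a MONOTONE (upper or lower) event `X` of probability `α ≤ 1/2`,
`Σ_i P(i pivotal for X)² ≤ C · α² · log(e/α)` with an absolute constant `C`
(`W¹[f] ≤ 2α² ln(1/α)` in Fourier normalisation, `|f̂(i)| = piv_i / 2` for monotone `f`; the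
level-1 inequality itself holds for every Boolean `f`, monotonicity is only used to read `f̂(i)` as a
pivotality).  Stated with `∃ C`.  Needs Bonami hypercontractivity; not in Mathlib; size L. -/
def levelOne_stmt : Prop :=
  ∃ C : ℝ, 0 < C ∧ ∀ (ι : Type) [DecidableEq ι] (D : Finset ι) (X : Set (Finset ι)),
    (IsUpperSet X ∨ IsLowerSet X) → PrW D (fun _ => (1 / 2 : ℝ)) X ≤ 1 / 2 →
      0 < PrW D (fun _ => (1 / 2 : ℝ)) X →
      ∑ i ∈ D, pivotality D (fun _ => (1 / 2 : ℝ)) X i ^ 2 ≤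
        C * PrW D (fun _ => (1 / 2 : ℝ)) X ^ 2 *
          Real.log (Real.exp 1 / PrW D (fun _ => (1 / 2 : ℝ)) X)

/-- **The combined tool (T1 of the census, pure algebra from the two inputs + Cauchy–Schwarz)**:
in the `1/2`-normal form, an upper (or lower) set `X` of probability `α ≤ 1/2` decided by a tree
with squared revealment `R = Σ_i δ_i(T)²` satisfies `(1 − α)² ≤ (C/4) · R · log(e/α)`, hence
`α ≤ e · exp(−1/(C R))` for `α ≤ 1/2`.  With `X = {o ↮ b}` (a lower set, same pivotalities as its
complement): `P(o ↮ b) ≤ e · exp(−1 / (C · Σ_e δ_e(T)²))` for EVERY tree `T` deciding `o ↔ b`. -/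
def lowRevealmentBound_stmt : Prop :=
  ∃ C : ℝ, 0 < C ∧ ∀ (ι : Type) [DecidableEq ι] (D : Finset ι) (T : DTree ι) (X : Set (Finset ι)),
    IsLowerSet X → LocalOn (revealed T) X → PrW D (fun _ => (1 / 2 : ℝ)) X ≤ 1 / 2 →
      0 < PrW D (fun _ => (1 / 2 : ℝ)) X →
      (1 - PrW D (fun _ => (1 / 2 : ℝ)) X) ^ 2 ≤
        C / 4 * (∑ i ∈ D, revealment D (fun _ => (1 / 2 : ℝ)) T i ^ 2) *
          Real.log (Real.exp 1 / PrW D (fun _ => (1 / 2 : ℝ)) X)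

end Finitary

end Summit.CriticalPhenomena.PercolationContinuityZ3.Cruxes.NearOneGluing.StrategistS3
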